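import Literature.MathematicalPhysics.QuantumFieldTheory.Balaban1983to89.B8Eq119TwistedAxial
import Literature.MathematicalPhysics.QuantumFieldTheory.Balaban1983to89.B7Prop6Flat
import HarnessLib

/-!
# Route `UnitScaleTilt`, crux K1 child «MinimiserStabilityRegPr» (stmt-QuantumFields-19200), stub EX, route (α), node (AVG-SYM) — (46)-tw, the `ȟ` row, `ℤᵈ` CORE:
# **THE COVARIANTLY-CONSTANT EXTENSION OF TOP-LEVEL GAUGE DATA DOWN THE TOWER OF AVERAGES, AND THE GAUGE CURVE IT GENERATES STAYS IN `Ax_k(·, U₀)` ((1.19)) FOR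
# EVERY `t`** — the `ℤᵈ` letters of this seat's `ȟ` supplier (OWNER ACK 15 (b); consumer ★w5-20520 g3's `Prop7SymAvgTwOfRegPr.exists_rightInv_QTw_of_regPr`, binders
# `hExt`∕`hExt_centre`∕`hExt_ax`∕`hExt_b`)

Cell `ym3-torus`, width seat `ym-ust-20520-w3` (gen 4).  Definitions (review lane) + theorems; 0 `sorry`.  YM₃ on T³ is a ladder rung (R3), NOT the Clay problem; nothing here
claims the stub, the crux, d = 4 or the mass gap.  `--supports stmt-QuantumFields-19200 --as helper`; count-neutral.

THE PRINT.  [Balaban1985RegularSpaces] p. 79 (1.19): «for `x₀ ∈ Bʲ(x_j)`, `x_j ∈ Λ_j`, … a sequence of points `x₀, x₁, …, x_j` … `(R̄ⁿ_{0,x_{n+1}}Ũ′ⁿ)(Γ_{x_{n+1},x_n}) = 1`»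
— the axial gauge `Ax_k(𝔅_k, U₀)` RELATIVE to `U₀` is the statement that along every block contour of every level the average of `U′U₀` has the SAME transport as the average of
`U₀`; p. 98 (the tower gauge transformation `u_j(x) = u_{j+1}(z)·W_j(Γ_{Lz,x})`, tree `B8Eq115GaugeFixing.tg`).  [Balaban1985Averaging] (11) p. 19, p. 24 «(\overline{U^u})_c =
u(c₋)Ū_c u⁻¹(c₊)» for EVERY invertible gauge function (tree `B7Prop6Flat.avgIter_gaugeAct_units`, no smallness); p. 28 (gauge directions `A ↦ A − D_{V₀}λ`).
[Balaban1985BackgroundPropagators] (3.18)–(3.21) p. 393 (the restricted gauge parameters: `λ` determined by its values at the centres, extended covariantly along the tree).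

THE OBJECTS (all `ℤᵈ`-carrier letters of `B7Prop1Explicit`∕`B7Prop2Explicit`∕`B8Eq115GaugeFixing`).  For a configuration `V` (the pulled-back background), block size `L`,
depth `k`: `truncTower L V k` = the tower of averages `Ū₀ʲ = avgIter L V j`, `j < k`, with the TOP LEVEL SWITCHED OFF (`≡ 1` at `j = k`); `towerT L V k w := tg L (truncTower L V k) k 0 k w`
= the WITHIN-TOWER transport `Ū₀^{k−1}(Γ_{Lz_k,z_{k−1}})·…·Ū₀⁰(Γ_{Lz₁,w})` from the `k`-corner `Lᵏz_k`, `z_k = flᵏ w`, down to the fine site `w` (top level off ⇒ no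
dependence on a top base point, `towerT (Lᵏq) = 1`); `ccExt L V k η̃ w := (towerT w)⁻¹·η̃(flᵏ w)·(towerT w)` — print's covariantly-constant extension of the top-level datum `η̃`.

WHAT THIS FILE PROVES (pure algebra over the tree's identities — NO smallness anywhere except the unitarity input of §4).
* §1 `iterate_fl_pow_smul`, `iterate_fl_towerTop_smul`, `iterate_fl_towerTop_block` (the `k`-corner of `Lᵐ·Lz` and of `Lᵐ·(Lz + r)` agree, `m + 1 ≤ k`).
* §2 `truncTower_of_lt`, `truncTower_top`, `towerT_pow_smul` (`towerT (Lᵏq) = 1`), ★`ccExt_pow_smul` (`ccExt η̃ (Lᵏq) = η̃ q` — the CENTRE row), `ccExt_add`∕`ccExt_smul` (linearity in `η̃`),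
  `expUnit_smul_ccExt` (`e^{t·ccExt η̃ w} = (towerT w)⁻¹·e^{t·η̃(flᵏw)}·(towerT w)`).
* §3 ★★★`axialFn_avgIter_gaugeAct_ccExt` — FOR EVERY `t : ℂ`, every `n < k`, `z`, `r`:
  `Ū^{m}[(e^{t·ccExt η̃})•V](Γ_{Lz,Lz+r}) = Ū₀^{m}(Γ_{Lz,Lz+r})`, `m = k − (n+1)` — i.e. the gauge curve generated by `ccExt η̃` satisfies (1.19) between ALL consecutive levels
  (`avgIter_gaugeAct_units` ∘ `axialFn_gaugeAct` ∘ `h15_of_cov` at the truncated tower: the `towerT`-conjugate of the gauge is CONSTANT on each `k`-tower); ★★`inAx_gaugeAct_ccExt` —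
  hence `(e^{t·ccExt η̃})•V ∈ InAx L k Λ V` for EVERY `Λ` and EVERY `t`.
* §4 `towerT_mem` (the transport is `S`-valued when the averages below level `k` are), ★`norm_ccExt_le` (`S ≤ U1 ⇒ ‖ccExt η̃ w‖ ≤ ‖η̃ (flᵏ w)‖`).
HONEST SCOPE.  `ℤᵈ` algebra only; the T³ reading (`pull`∕`basePt`∕`embIter`, periodicity, `RegPr ⇒` unitarity of the averages, the `D_{U₀}`-factor `2`) is the companion
`…Prop7SymAvgTwCovConstExt`.  Nothing of [Balaban1985RegularSpaces] Theorem 4 or [Balaban1985BackgroundPropagators] is asserted.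

References: T. Bałaban, CMP **99** (1985) 75–102 [Balaban1985RegularSpaces] ((1.14)–(1.15) p.78, (1.19)–(1.20) p.79, p.98); CMP **98** (1985) 17–51 [Balaban1985Averaging]
((8) p.18, (11) p.19, p.24, p.28, (43) p.24); CMP **99** (1985) 389–434 [Balaban1985BackgroundPropagators] ((3.18)–(3.21) p.393).
-/

set_option autoImplicit false

noncomputable section

open scoped BigOperators

namespace Summit.QuantumFields.YangMills.Theorems.Prop7TowerCovConstExt

open NormedSpace
open Literature.MathematicalPhysics.QuantumFieldTheory.Balaban1983to89
open B7Prop1Explicit B7Prop2Explicit B7AvgGaugeCovariance B8Eq115GaugeFixing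
open B8Ineq130 (fl axialFn_one)
open B8Eq119TwistedAxial (InAx inAx_of_global eq_inv_mul_of_conj_eq_one)
open B7Prop6Flat (avgIter_gaugeAct_units)

variable {d : ℕ}

/-! ## §1 The `k`-corner below a fine site: iterated `fl` -/

section Blocks

/-- `flᵐ (Lᵐ·y) = y`. [folklore] -/
theorem iterate_fl_pow_smul {L : ℕ} (hL : 1 ≤ L) : ∀ (m : ℕ) (y : Site d), (fl L)^[m] (((L : ℤ) ^ m) • y) = y
  | 0, y => by simp
  | m + 1, y => by
    rw [Function.iterate_succ_apply, pow_succ', mul_smul, fl_smul hL]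
    exact iterate_fl_pow_smul hL m y

/-- The `k`-corner index of `Lᵐ·(L·z)` is `fl^{k−m−1} z` (`m + 1 ≤ k`). [folklore] -/
theorem iterate_fl_towerTop_smul {L : ℕ} (hL : 1 ≤ L) {k m : ℕ} (hmk : m + 1 ≤ k) (z : Site d) :
    (fl L)^[k] (((L : ℤ) ^ m) • ((L : ℤ) • z)) = (fl L)^[k - (m + 1)] z := by
  have hk : k = (k - (m + 1)) + (m + 1) := by omega
  conv_lhs => rw [hk]
  rw [Function.iterate_add_apply, smul_smul, ← pow_succ, iterate_fl_pow_smul hL]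

/-- The `k`-corner index of `Lᵐ·(L·z + r)`, `r ∈ [0, L)ᵈ`, is the same `fl^{k−m−1} z`. [folklore] -/
theorem iterate_fl_towerTop_block {L : ℕ} (hL : 1 ≤ L) {k m : ℕ} (hmk : m + 1 ≤ k) (z : Site d) (r : Fin d → Fin L) :
    (fl L)^[k] (((L : ℤ) ^ m) • ((L : ℤ) • z + boxVec L r)) = (fl L)^[k - (m + 1)] z := by
  have hk : k = (k - (m + 1)) + (m + 1) := by omega
  conv_lhs => rw [hk]
  rw [Function.iterate_add_apply, Function.iterate_succ_apply', iterate_fl_pow_smul hL, fl_block hL]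

end Blocks

/-! ## §2 The truncated tower, the within-tower transport, the covariantly-constant extension -/

section Objects

variable {𝔸 : Type*} [NormedRing 𝔸] [NormOneClass 𝔸] [NormedAlgebra ℂ 𝔸] [CompleteSpace 𝔸]

/-- **THE TRUNCATED TOWER OF AVERAGES**: `j ↦ Ū₀ʲ = avgIter L V j` for `j ≠ k`, and the TRIVIAL field at the top level `j = k` (so that the tower gauge of
`B8Eq115GaugeFixing.tg` built on it transports only WITHIN each `k`-tower). [cite: Balaban1985RegularSpaces, p.98; Balaban1985Averaging, (43) p.24] -/
def truncTower (L : ℕ) (V : Site d → Fin d → 𝔸ˣ) (k : ℕ) : ℕ → Site d → Fin d → 𝔸ˣ :=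
  fun j => if j = k then 1 else avgIter L V j

/-- **THE WITHIN-TOWER TRANSPORT** `towerT w = Ū₀^{k−1}(Γ_{Lz_k,z_{k−1}})·…·Ū₀⁰(Γ_{Lz₁,w})` from the `k`-corner down to the fine site `w` (print's `u` of p. 98 with the top level
switched off). [cite: Balaban1985RegularSpaces, (1.19) p.79, p.98] -/
def towerT (L : ℕ) (V : Site d → Fin d → 𝔸ˣ) (k : ℕ) : Site d → 𝔸ˣ :=
  tg L (truncTower L V k) k 0 k

/-- **THE COVARIANTLY-CONSTANT EXTENSION** of a top-level datum `η̃` (indexed by the `k`-lattice `ℤᵈ`) to the fine lattice: `ccExt η̃ w = (towerT w)⁻¹·η̃(flᵏ w)·(towerT w)` — the value at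
the `k`-corner transported down the tower along the (1.19) contours. [cite: Balaban1985BackgroundPropagators, (3.18)-(3.21) p.393; Balaban1985Averaging, p.28] -/
def ccExt (L : ℕ) (V : Site d → Fin d → 𝔸ˣ) (k : ℕ) (η : Site d → 𝔸) : Site d → 𝔸 :=
  fun w => (((towerT L V k w)⁻¹ : 𝔸ˣ) : 𝔸) * η ((fl L)^[k] w) * (towerT L V k w : 𝔸)

variable (L : ℕ) (V : Site d → Fin d → 𝔸ˣ) (k : ℕ)

omit [NormOneClass 𝔸] in
/-- Below the top the truncated tower IS the tower of averages. [cite: Balaban1985Averaging, (43) p.24] -/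
theorem truncTower_of_lt {j : ℕ} (hj : j < k) : truncTower L V k j = avgIter L V j := by
  unfold truncTower; rw [if_neg (by omega)]

omit [NormOneClass 𝔸] in
/-- The top level of the truncated tower is trivial. [folklore] -/
theorem truncTower_top : truncTower L V k k = 1 := by
  unfold truncTower; rw [if_pos rfl]

omit [NormOneClass 𝔸] in
/-- `towerT` unfolded. [cite: Balaban1985RegularSpaces, p.98] -/
theorem towerT_def : towerT L V k = tg L (truncTower L V k) k 0 k := rfl

omit [NormOneClass 𝔸] in
/-- **AT A `k`-CORNER THE TRANSPORT IS TRIVIAL**: `towerT (Lᵏ·q) = 1` (the top level is switched off). [cite: Balaban1985RegularSpaces, (1.14) p.78, p.98] -/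
theorem towerT_pow_smul {L : ℕ} (hL : 1 ≤ L) (V : Site d → Fin d → 𝔸ˣ) (k : ℕ) (q : Site d) : towerT L V k (((L : ℤ) ^ k) • q) = 1 := by
  have h := tg_add_pow_smul hL (truncTower L V k) k 0 0 k q
  rw [zero_add] at h
  rw [towerT_def, h, tg_zero, truncTower_top, axialFn_one]

omit [NormOneClass 𝔸] in
/-- `ccExt` unfolded. [cite: Balaban1985BackgroundPropagators, (3.18)-(3.21) p.393] -/
theorem ccExt_apply (η : Site d → 𝔸) (w : Site d) :
    ccExt L V k η w = (((towerT L V k w)⁻¹ : 𝔸ˣ) : 𝔸) * η ((fl L)^[k] w) * (towerT L V k w : 𝔸) := rfl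

omit [NormOneClass 𝔸] in
/-- ★ **THE CENTRE ROW**: at a `k`-corner the extension returns the datum, `ccExt η̃ (Lᵏ·q) = η̃ q`. [cite: Balaban1985BackgroundPropagators, (3.18) p.393] -/
theorem ccExt_pow_smul {L : ℕ} (hL : 1 ≤ L) (V : Site d → Fin d → 𝔸ˣ) (k : ℕ) (η : Site d → 𝔸) (q : Site d) :
    ccExt L V k η (((L : ℤ) ^ k) • q) = η q := by
  rw [ccExt_apply, towerT_pow_smul hL, iterate_fl_pow_smul hL, inv_one, Units.val_one, one_mul, mul_one]

omit [NormOneClass 𝔸] in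
/-- Linearity in the datum: additivity. [folklore] -/
theorem ccExt_add (η η' : Site d → 𝔸) : ccExt L V k (η + η') = ccExt L V k η + ccExt L V k η' := by
  funext w
  simp only [ccExt_apply, Pi.add_apply, mul_add, add_mul]

omit [NormOneClass 𝔸] in
/-- Linearity in the datum: homogeneity. [folklore] -/
theorem ccExt_smul (c : ℂ) (η : Site d → 𝔸) : ccExt L V k (c • η) = c • ccExt L V k η := by
  funext w
  simp only [ccExt_apply, Pi.smul_apply, mul_smul_comm, smul_mul_assoc]

omit [NormOneClass 𝔸] in
/-- **THE GAUGE IT GENERATES IS THE `towerT`-CONJUGATE OF A TOWER-WISE CONSTANT GAUGE**: `e^{t·ccExt η̃ w} = (towerT w)⁻¹·e^{t·η̃(flᵏ w)}·(towerT w)` (`exp` commutes with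
conjugation). [cite: Balaban1985Averaging, (8) p.18] -/
theorem expUnit_smul_ccExt (η : Site d → 𝔸) (t : ℂ) (w : Site d) :
    expUnit (t • ccExt L V k η w) = (towerT L V k w)⁻¹ * expUnit (t • η ((fl L)^[k] w)) * towerT L V k w := by
  letI : NormedAlgebra ℚ 𝔸 := NormedAlgebra.restrictScalars ℚ ℂ 𝔸
  apply Units.ext
  rw [Units.val_mul, Units.val_mul, val_expUnit, val_expUnit, ccExt_apply, ← smul_mul_assoc, ← mul_smul_comm]
  exact exp_units_conj' (towerT L V k w) (t • η ((fl L)^[k] w))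

end Objects

/-! ## §3 ★★★ The gauge curve generated by `ccExt` satisfies (1.19) between all consecutive levels, for every `t` -/

section Axial

variable {𝔸 : Type*} [NormedRing 𝔸] [NormOneClass 𝔸] [NormedAlgebra ℂ 𝔸] [CompleteSpace 𝔸]

omit [NormOneClass 𝔸] in
/-- **(1.15) FOR THE TRUNCATED TOWER IN ITS OWN TOWER GAUGE** (`h15_of_cov` with `hcov := rfl`): for `m = k − (n+1)`, `n < k`,
`towerT(Lᵐ·Lz) · Ū₀^{m}(Γ_{Lz,Lz+r}) · towerT(Lᵐ·(Lz+r))⁻¹ = 1`. [cite: Balaban1985RegularSpaces, (1.15) p.78, p.98] -/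
theorem towerT_conj_axialFn_eq_one {L : ℕ} (hL : 1 ≤ L) (V : Site d → Fin d → 𝔸ˣ) {k n : ℕ} (hn : n < k) (z : Site d) (r : Fin d → Fin L) :
    towerT L V k (((L : ℤ) ^ (k - (n + 1))) • ((L : ℤ) • z)) * axialFn (avgIter L V (k - (n + 1))) ((L : ℤ) • z) ((L : ℤ) • z + boxVec L r) *
      (towerT L V k (((L : ℤ) ^ (k - (n + 1))) • ((L : ℤ) • z + boxVec L r)))⁻¹ = 1 := by
  have h := h15_of_cov hL (truncTower L V k) (fun j => gaugeAct (uLev L (tg L (truncTower L V k) k 0 k) j) (truncTower L V k j)) k 0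
    (fun _ _ => rfl) n hn z r
  rw [truncTower_of_lt L V k (by omega : k - (n + 1) < k), axialFn_gaugeAct, uLev_apply, uLev_apply] at h
  exact h

omit [NormOneClass 𝔸] in
/-- ★★★ **THE GAUGE CURVE OF THE COVARIANTLY-CONSTANT EXTENSION SATISFIES (1.19) AT EVERY LEVEL, FOR EVERY `t`**: with `g_t(w) := e^{t·ccExt η̃ w}` (a unit-valued, in general
NON-unitary gauge function), for all `n < k`, `z`, `r`: `\overline{(g_t•V)}^{m}(Γ_{Lz,Lz+r}) = V̄^{m}(Γ_{Lz,Lz+r})`, `m = k − (n+1)` — covariance of (43) for arbitrary invertible gauges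
(`avgIter_gaugeAct_units`), (8) on the tree contour, (1.15) for the truncated tower in its own gauge, and the fact that `towerT·g_t·towerT⁻¹ = e^{t·η̃∘flᵏ}` is CONSTANT on each
`k`-tower. [cite: Balaban1985RegularSpaces, (1.19) p.79; Balaban1985Averaging, (11) p.19, p.24, (8) p.18] -/
theorem axialFn_avgIter_gaugeAct_ccExt {L : ℕ} (hL : 1 ≤ L) (V : Site d → Fin d → 𝔸ˣ) (k : ℕ) (η : Site d → 𝔸) (t : ℂ)
    {n : ℕ} (hn : n < k) (z : Site d) (r : Fin d → Fin L) :
    axialFn (avgIter L (gaugeAct (fun w => expUnit (t • ccExt L V k η w)) V) (k - (n + 1))) ((L : ℤ) • z) ((L : ℤ) • z + boxVec L r) =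
      axialFn (avgIter L V (k - (n + 1))) ((L : ℤ) • z) ((L : ℤ) • z + boxVec L r) := by
  set m := k - (n + 1) with hm
  have hmk : m + 1 ≤ k := by omega
  -- covariance of the averages for the (non-unitary) gauge, then (8) on the tree contour
  rw [avgIter_gaugeAct_units L _ V m, axialFn_gaugeAct, uLev_apply, uLev_apply, expUnit_smul_ccExt, expUnit_smul_ccExt,
    iterate_fl_towerTop_smul hL hmk, iterate_fl_towerTop_block hL hmk]
  -- (1.15) in the tower gauge: the transport is `towerT(·)⁻¹ towerT(·)`
  have h15 := towerT_conj_axialFn_eq_one hL V hn z r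
  rw [← hm] at h15
  have hA := eq_inv_mul_of_conj_eq_one h15
  rw [hA]
  -- group algebra: `a⁻¹Ea · a⁻¹b · (b⁻¹Eb)⁻¹ = a⁻¹b`
  set a := towerT L V k (((L : ℤ) ^ m) • ((L : ℤ) • z))
  set b := towerT L V k (((L : ℤ) ^ m) • ((L : ℤ) • z + boxVec L r))
  set E := expUnit (t • η ((fl L)^[k - (m + 1)] z))
  group

omit [NormOneClass 𝔸] in
/-- ★★ **`(e^{t·ccExt η̃})•V ∈ Ax_k(ℭ, V)` FOR EVERY `ℭ` AND EVERY `t`** (`B8Eq119TwistedAxial.InAx`, via `inAx_of_global`). [cite: Balaban1985RegularSpaces, (1.19) p.79] -/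
theorem inAx_gaugeAct_ccExt {L : ℕ} (hL : 1 ≤ L) (V : Site d → Fin d → 𝔸ˣ) (k : ℕ) (η : Site d → 𝔸) (t : ℂ) (Λ : ℕ → Set (Site d)) :
    InAx L k Λ V (gaugeAct (fun w => expUnit (t • ccExt L V k η w)) V) :=
  inAx_of_global (fun _ hn z r => axialFn_avgIter_gaugeAct_ccExt hL V k η t hn z r) Λ

end Axial

/-! ## §4 Unitarity of the transport and the sup bound of the extension -/

section Norm

variable {𝔸 : Type*} [NormedRing 𝔸] [NormOneClass 𝔸] [NormedAlgebra ℂ 𝔸] [CompleteSpace 𝔸]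

omit [NormOneClass 𝔸] in
/-- If the averages `Ū₀ʲ`, `j < k`, are `S`-valued (e.g. `SU(2)` — [Balaban1985Averaging] Prop. 2 at a regular background), the within-tower transport is `S`-valued.
[cite: Balaban1985Averaging, Prop. 2 p.22] -/
theorem towerT_mem {S : Subgroup 𝔸ˣ} (L : ℕ) {V : Site d → Fin d → 𝔸ˣ} {k : ℕ} (hV : ∀ j < k, ∀ x κ, avgIter L V j x κ ∈ S) (w : Site d) : towerT L V k w ∈ S := by
  refine tg_mem (S := S) (W := truncTower L V k) (fun j hj x κ => ?_) 0 k w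
  rcases Nat.lt_or_ge j k with hjk | hjk
  · rw [truncTower_of_lt L V k hjk]; exact hV j hjk x κ
  · have : j = k := le_antisymm hj hjk
    subst this
    rw [truncTower_top]; exact S.one_mem

/-- ★ **THE SUP BOUND**: for `U1`-valued (norm-`≤ 1` with norm-`≤ 1` inverse, e.g. unitary) averages below level `k`, `‖ccExt η̃ w‖ ≤ ‖η̃ (flᵏ w)‖`.
[cite: Balaban1985Averaging, (19) p.21; Balaban1985BackgroundPropagators, (3.18) p.393] -/
theorem norm_ccExt_le (L : ℕ) {V : Site d → Fin d → 𝔸ˣ} {k : ℕ} (hV : ∀ j < k, ∀ x κ, avgIter L V j x κ ∈ U1 𝔸) (η : Site d → 𝔸) (w : Site d) :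
    ‖ccExt L V k η w‖ ≤ ‖η ((fl L)^[k] w)‖ := by
  obtain ⟨h1, h2⟩ := towerT_mem (S := U1 𝔸) L hV w
  rw [ccExt_apply]
  calc ‖(((towerT L V k w)⁻¹ : 𝔸ˣ) : 𝔸) * η ((fl L)^[k] w) * (towerT L V k w : 𝔸)‖
      ≤ ‖(((towerT L V k w)⁻¹ : 𝔸ˣ) : 𝔸)‖ * ‖η ((fl L)^[k] w)‖ * ‖(towerT L V k w : 𝔸)‖ :=
        (norm_mul_le _ _).trans (mul_le_mul_of_nonneg_right (norm_mul_le _ _) (norm_nonneg _))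
    _ ≤ 1 * ‖η ((fl L)^[k] w)‖ * 1 := by gcongr
    _ = ‖η ((fl L)^[k] w)‖ := by ring

end Norm

end Summit.QuantumFields.YangMills.Theorems.Prop7TowerCovConstExt

end
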